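import Literature.Topology.FourManifolds.GenericMapNormalForms
import Literature.Topology.FourManifolds.CuspIsolated
import Literature.Topology.FourManifolds.FoldNearby
import HarnessLib

/-!
# A generic map of a closed 4-manifold has finitely many cusps

Topic `Literature/Topology/FourManifolds` (programme of the fact
`Literature.Topology.FourManifolds.exists_isSimplifiedBrokenLefschetzFibration`, Baykur–Saeki 2017, §2.1
p. 6: the singular locus of a generic map `X⁴ → Σ²` consists of fold circles and finitely many
cusps).  Refining `GenericMapNormalForms.exists_generic_map_sphere`: every compact boundaryless
`C^∞` 4-manifold carries a `C^∞` map `g : M → S²` together with a FINITE set `S ⊆ M` such that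
every point of `S` is a cusp point with Whitney data (charts of `M` and `S²` with
`ψ ∘ g = (φ₀, h(φ₀, φ₁) + ε₂φ₂² + ε₃φ₃²)`, `h = hₜ = hₓ = hₓₓ = 0`, `hₓₓₓ ≠ 0`, `hₜₓ ≠ 0` at `0`)
and every critical point off `S` is a fold point with charts
`ψ ∘ g = (φ₀, s₁φ₁² + s₂φ₂² + s₃φ₃²)`, `sᵢ = ±1` — the format of the `lefschetz`/`fold`
clauses of `IsSimplifiedBrokenLefschetzFibration`.  Finiteness: every point of `M` has a
punctured neighbourhood free of non-fold critical points (regular points are stable,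
`FoldNearby`; near a fold chart all critical points are folds, `FoldNearby`; near Whitney cusp
data all other critical points are folds, `CuspIsolated`), and `M` is compact.

* `HasManifoldFoldChart g p`, `HasManifoldWhitneyCuspCharts g p` — the two clauses;
* `exists_generic_map_of_chart_finite_cusps`, **`exists_generic_map_sphere_finite_cusps`**.

Everything is proved; the two clause predicates are the only definitions; no named facts
(D-0026).

## References

* R. İ. Baykur, O. Saeki, *Simplifying indefinite fibrations on 4-manifolds*, arXiv:1705.11169,
  §2.1 p. 6, §6 p. 19. [BaykurSaeki2017]
* M. Golubitsky, V. Guillemin, *Stable Mappings and Their Singularities*, GTM 14 (1973), Ch. III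
  §4; Ch. VI §2. [GolubitskyGuillemin1973]
-/

noncomputable section

set_option maxSynthPendingDepth 2

open Set Function Filter Module
open scoped ContDiff Topology Manifold

namespace Literature.Topology.FourManifolds

/-- Local notation for this file: the model space `ℝⁿ = EuclideanSpace ℝ (Fin n)`. -/
local notation "𝔼 " n:arg => EuclideanSpace ℝ (Fin n)

/-- Local notation: the round 2-sphere. -/
local notation "𝕊²" => Metric.sphere (0 : EuclideanSpace ℝ (Fin 3)) 1

section Clauses

variable {X : Type*} [TopologicalSpace X] [ChartedSpace (𝔼 4) X]
  {B : Type*} [TopologicalSpace B] [ChartedSpace (𝔼 2) B]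

/-- **Fold point with charts** of `g : X → B` at `p`: smooth charts `φ` of `X` centred at `p`
and `ψ` of `B` with `ψ ∘ g = (φ₀, s₁φ₁² + s₂φ₂² + s₃φ₃²)` on `φ.source`, `sᵢ = ±1`.
[cite: BaykurSaeki2017, §2.1, p. 6] -/
def HasManifoldFoldChart (g : X → B) (p : X) : Prop :=
  ∃ (s₁ s₂ s₃ : ℝ) (φ : OpenPartialHomeomorph X (𝔼 4)) (ψ : OpenPartialHomeomorph B (𝔼 2)),
    s₁ ^ 2 = 1 ∧ s₂ ^ 2 = 1 ∧ s₃ ^ 2 = 1 ∧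
    p ∈ φ.source ∧ φ p = 0 ∧ MapsTo g φ.source ψ.source ∧
    ContMDiffOn (𝓡 4) (𝓡 4) ∞ φ φ.source ∧ ContMDiffOn (𝓡 4) (𝓡 4) ∞ φ.symm φ.target ∧
    ContMDiffOn (𝓡 2) (𝓡 2) ∞ ψ ψ.source ∧ ContMDiffOn (𝓡 2) (𝓡 2) ∞ ψ.symm ψ.target ∧
    ∀ q ∈ φ.source, (ψ (g q)) 0 = (φ q) 0 ∧
      (ψ (g q)) 1 = s₁ * (φ q) 1 ^ 2 + s₂ * (φ q) 2 ^ 2 + s₃ * (φ q) 3 ^ 2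

/-- **Cusp point with Whitney data, in charts** of `g : X → B` at `p`: smooth charts with
`ψ ∘ g = (φ₀, h(φ₀, φ₁) + ε₂φ₂² + ε₃φ₃²)` on `φ.source`, `εᵢ = ±1`, and
`h = hₜ = hₓ = hₓₓ = 0`, `hₓₓₓ ≠ 0`, `hₜₓ ≠ 0` at `0` (the hypotheses of Whitney's cusp theorem).
[cite: BaykurSaeki2017, §2.1, p. 6] [cite: GolubitskyGuillemin1973, Ch. VI §2, Thm. 2.4] -/
def HasManifoldWhitneyCuspCharts (g : X → B) (p : X) : Prop :=
  ∃ (φ : OpenPartialHomeomorph X (𝔼 4)) (ψ : OpenPartialHomeomorph B (𝔼 2))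
    (h : ℝ × ℝ → ℝ) (U : Set (ℝ × ℝ)) (ε₂ ε₃ : ℝ),
    p ∈ φ.source ∧ φ p = 0 ∧ MapsTo g φ.source ψ.source ∧
    ContMDiffOn (𝓡 4) (𝓡 4) ∞ φ φ.source ∧ ContMDiffOn (𝓡 4) (𝓡 4) ∞ φ.symm φ.target ∧
    ContMDiffOn (𝓡 2) (𝓡 2) ∞ ψ ψ.source ∧ ContMDiffOn (𝓡 2) (𝓡 2) ∞ ψ.symm ψ.target ∧
    IsOpen U ∧ ContDiffOn ℝ ∞ h U ∧ (∀ q ∈ φ.source, ((φ q) 0, (φ q) 1) ∈ U) ∧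
    ε₂ ^ 2 = 1 ∧ ε₃ ^ 2 = 1 ∧
    (∀ q ∈ φ.source, ψ (g q) 0 = φ q 0 ∧
      ψ (g q) 1 = h ((φ q) 0, (φ q) 1) + ε₂ * (φ q) 2 ^ 2 + ε₃ * (φ q) 3 ^ 2) ∧
    h 0 = 0 ∧ fderiv ℝ h 0 ((1 : ℝ), (0 : ℝ)) = 0 ∧ fderiv ℝ h 0 ((0 : ℝ), (1 : ℝ)) = 0 ∧
    fderiv ℝ (fderiv ℝ h) 0 ((0 : ℝ), (1 : ℝ)) ((0 : ℝ), (1 : ℝ)) = 0 ∧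
    fderiv ℝ (fderiv ℝ (fderiv ℝ h)) 0 ((0 : ℝ), (1 : ℝ)) ((0 : ℝ), (1 : ℝ)) ((0 : ℝ), (1 : ℝ)) ≠ 0 ∧
    fderiv ℝ (fderiv ℝ h) 0 ((1 : ℝ), (0 : ℝ)) ((0 : ℝ), (1 : ℝ)) ≠ 0

/-- **Fold chart at a fold point of a global representative** (any smooth chart `Φ₀` of `X`
containing `q`). [cite: BaykurSaeki2017, §2.1] -/
theorem hasManifoldFoldChart_of_isFoldPointAt {g : X → B}
    {Φ₀ : OpenPartialHomeomorph X (𝔼 4)} {Ψ₀ : OpenPartialHomeomorph B (𝔼 2)}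
    (hΦ₀ : ContMDiffOn (𝓡 4) (𝓡 4) ∞ Φ₀ Φ₀.source)
    (hΦ₀s : ContMDiffOn (𝓡 4) (𝓡 4) ∞ Φ₀.symm Φ₀.target)
    (hΨ₀ : ContMDiffOn (𝓡 2) (𝓡 2) ∞ Ψ₀ Ψ₀.source)
    (hΨ₀s : ContMDiffOn (𝓡 2) (𝓡 2) ∞ Ψ₀.symm Ψ₀.target)
    (hmaps : MapsTo g Φ₀.source Ψ₀.source) {q : X} (hq : q ∈ Φ₀.source) {G : 𝔼 4 → 𝔼 2}
    (hG : ContDiff ℝ ∞ G) (hGf : G =ᶠ[𝓝 (Φ₀ q)] (Ψ₀ ∘ g ∘ Φ₀.symm))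
    (hne : fderiv ℝ G (Φ₀ q) ≠ 0) (hfold : OneJet.IsFoldPointAt G (Φ₀ q)) :
    HasManifoldFoldChart g q := by
  obtain ⟨s₁, s₂, s₃, hs₁, hs₂, hs₃, hchart⟩ := exists_hasFoldChartSig_of_isFoldPointAt hG hne hfold
  obtain ⟨φ, ψ, h1, h2, h3, h4, h5, h6, h7, h8⟩ := exists_foldChartSig_of_hasFoldChartSig hΦ₀ hΦ₀s
    hΨ₀ hΨ₀s hmaps hq (hchart.congr_of_eventuallyEq hGf)
  exact ⟨s₁, s₂, s₃, φ, ψ, hs₁, hs₂, hs₃, h1, h2, h3, h4, h5, h6, h7, h8⟩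

end Clauses

/-! ### The main theorem -/

section Main

variable {B : Type*} [TopologicalSpace B] [ChartedSpace (𝔼 2) B]

/-- **Generic maps into a surface chart, with finitely many cusps.**  Let `Ψ₀` be a smooth
chart of the surface `B` with target all of `ℝ²`.  Every compact boundaryless `C^∞`
4-manifold `M` carries a `C^∞` map `g : M → B` (with image in `Ψ₀.source`) and a finite set
`S ⊆ M` such that every point of `S` is a cusp point with Whitney data in charts and every
critical point off `S` is a fold point with charts. [cite: BaykurSaeki2017, §2.1 p. 6] -/
theorem exists_generic_map_of_chart_finite_cusps [IsManifold (𝓡 2) ∞ B]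
    (Ψ₀ : OpenPartialHomeomorph B (𝔼 2)) (hΨ₀ : ContMDiffOn (𝓡 2) (𝓡 2) ∞ Ψ₀ Ψ₀.source)
    (hΨ₀s : ContMDiffOn (𝓡 2) (𝓡 2) ∞ Ψ₀.symm Ψ₀.target) (htarget : Ψ₀.target = univ)
    (M : Type*) [TopologicalSpace M] [T2Space M] [CompactSpace M] [ChartedSpace (𝔼 4) M]
    [IsManifold (𝓡 4) ∞ M] :
    ∃ g : M → B, ContMDiff (𝓡 4) (𝓡 2) ∞ g ∧ (∀ q, g q ∈ Ψ₀.source) ∧ ∃ S : Finset M,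
      (∀ p ∈ S, HasManifoldWhitneyCuspCharts g p) ∧
      ∀ p : M, ¬ Surjective (mfderiv (𝓡 4) (𝓡 2) g p) → p ∉ S → HasManifoldFoldChart g p := by
  classical
  obtain ⟨f, hf, hgen⟩ := OneJet.exists_twoGeneric_map M
  have hft : ∀ q, f q ∈ Ψ₀.target := fun q => by simp [htarget]
  set g : M → B := fun q => Ψ₀.symm (f q) with hg
  have hgs : ContMDiff (𝓡 4) (𝓡 2) ∞ g := hΨ₀s.comp_contMDiff hf hft
  have hgsrc : ∀ q, g q ∈ Ψ₀.source := fun q => Ψ₀.map_target (hft q)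
  have hΨg : ∀ q, Ψ₀ (g q) = f q := fun q => Ψ₀.right_inv (hft q)
  -- a global representative of the germ of `f ∘ φ_p⁻¹` at `φ_p p`, for every `p`
  choose G hG heq using fun p : M => exists_contDiff_eventuallyEq_planeRep
    (isOpen_extChartAt_target p) (contDiffOn_comp_extChartAt_symm_target (I := 𝓡 4) hf p)
    (mem_extChartAt_target (I := 𝓡 4) p)
  -- notation: `Φ p = chartAt p`
  have hΦs : ∀ p : M, ContMDiffOn (𝓡 4) (𝓡 4) ∞ (chartAt (𝔼 4) p) (chartAt (𝔼 4) p).source :=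
    fun p => contMDiffOn_chart
  have hΦss : ∀ p : M,
      ContMDiffOn (𝓡 4) (𝓡 4) ∞ (chartAt (𝔼 4) p).symm (chartAt (𝔼 4) p).target :=
    fun p => contMDiffOn_chart_symm
  have hrep : ∀ p : M, (Ψ₀ ∘ g ∘ (chartAt (𝔼 4) p).symm) = f ∘ (extChartAt (𝓡 4) p).symm := by
    intro p
    funext y
    simp [hΨg]
  have hpt : ∀ p : M, extChartAt (𝓡 4) p p = chartAt (𝔼 4) p p := fun p => by simp
  have hGf : ∀ p : M, G p =ᶠ[𝓝 (chartAt (𝔼 4) p p)] (Ψ₀ ∘ g ∘ (chartAt (𝔼 4) p).symm) := by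
    intro p
    rw [hrep, ← hpt]
    exact heq p
  have hne : ∀ p : M, fderiv ℝ (G p) (chartAt (𝔼 4) p p) ≠ 0 := fun p => by
    rw [← hpt, (heq p).fderiv_eq]
    exact (hgen p).1
  have htr : ∀ p : M, OneJet.IsOneJetTransverseAt (G p) (chartAt (𝔼 4) p p) := fun p =>
    hpt p ▸ (OneJet.isOneJetTransverseAt_congr_of_eventuallyEq (heq p)).2 (hgen p).2.1
  have hcg : ∀ p : M, OneJet.IsCuspGenericAt (G p) (chartAt (𝔼 4) p p) := fun p =>
    hpt p ▸ (OneJet.isCuspGenericAt_congr_of_eventuallyEq (heq p)).2 (hgen p).2.2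
  have hmaps : ∀ p : M, MapsTo g (chartAt (𝔼 4) p).source Ψ₀.source := fun p q _ => hgsrc q
  -- Key local statement: near every `p`, every critical point `≠ p` is a fold point with charts
  have hE : ∀ p : M, ∀ᶠ q in 𝓝 p, q ≠ p → ¬ Surjective (mfderiv (𝓡 4) (𝓡 2) g q) →
      HasManifoldFoldChart g q := by
    intro p
    set Φ := chartAt (𝔼 4) p with hΦ
    have hpΦ : p ∈ Φ.source := mem_chart_source _ p
    obtain ⟨N, hNsub, hNo, hpN⟩ : ∃ N ⊆ {y | G p y = (Ψ₀ ∘ g ∘ Φ.symm) y}, IsOpen N ∧ Φ p ∈ N :=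
      _root_.mem_nhds_iff.1 (hGf p)
    have hGfq : ∀ q, Φ q ∈ N → G p =ᶠ[𝓝 (Φ q)] (Ψ₀ ∘ g ∘ Φ.symm) := fun q hq =>
      eventually_of_mem (hNo.mem_nhds hq) fun y hy => hNsub hy
    have hcrit_iff : ∀ q ∈ Φ.source, Φ q ∈ N →
        (Surjective (mfderiv (𝓡 4) (𝓡 2) g q) ↔ Surjective (fderiv ℝ (G p) (Φ q))) :=
      fun q hq hqN => surjective_mfderiv_iff_of_localRepresentative (hΦs p) (hΦss p) hΨ₀ hΨ₀s
        (hmaps p) hq ((hG p).differentiable (by simp) _) (hGfq q hqN)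
    have hfold_clause : ∀ q ∈ Φ.source, Φ q ∈ N → fderiv ℝ (G p) (Φ q) ≠ 0 →
        OneJet.IsFoldPointAt (G p) (Φ q) → HasManifoldFoldChart g q :=
      fun q hq hqN hneq hfold => hasManifoldFoldChart_of_isFoldPointAt (hΦs p) (hΦss p) hΨ₀ hΨ₀s
        (hmaps p) hq (hG p) (hGfq q hqN) hneq hfold
    have hcont : ContinuousAt Φ p := Φ.continuousAt hpΦ
    have hS1 : ∀ᶠ q in 𝓝 p, q ∈ Φ.source := Φ.open_source.mem_nhds hpΦ
    have hS2 : ∀ᶠ q in 𝓝 p, Φ q ∈ N := hcont.eventually (hNo.mem_nhds hpN)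
    have hS3 : ∀ᶠ q in 𝓝 p, fderiv ℝ (G p) (Φ q) ≠ 0 :=
      hcont.eventually (eventually_fderiv_ne_zero (hG p) (by simp) (hne p))
    by_cases hsurj : Surjective (fderiv ℝ (G p) (Φ p))
    · -- regular point: no critical points nearby
      have hS4 : ∀ᶠ q in 𝓝 p, Surjective (fderiv ℝ (G p) (Φ q)) :=
        hcont.eventually (eventually_surjective_fderiv (hG p) (by simp) hsurj)
      filter_upwards [hS1, hS2, hS4] with q h1 h2 h4 _ hcrit
      exact absurd ((hcrit_iff q h1 h2).2 h4) hcrit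
    rcases OneJet.isFoldPointAt_or_isCuspCandidateAt hsurj (hne p) with hfold | hcc
    · -- fold point: nearby critical points are fold points
      obtain ⟨s₁, s₂, s₃, hs₁, hs₂, hs₃, hchart⟩ :=
        exists_hasFoldChartSig_of_isFoldPointAt (hG p) (hne p) hfold
      have hs₁0 : s₁ ≠ 0 := by rintro rfl; norm_num at hs₁
      have hs₂0 : s₂ ≠ 0 := by rintro rfl; norm_num at hs₂
      have hs₃0 : s₃ ≠ 0 := by rintro rfl; norm_num at hs₃
      have hS4 : ∀ᶠ q in 𝓝 p, ¬ Surjective (fderiv ℝ (G p) (Φ q)) →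
          OneJet.IsFoldPointAt (G p) (Φ q) :=
        hcont.eventually (hchart.eventually_isFoldPointAt hs₁0 hs₂0 hs₃0)
      filter_upwards [hS1, hS2, hS3, hS4] with q h1 h2 h3 h4 _ hcrit
      have hcritG : ¬ Surjective (fderiv ℝ (G p) (Φ q)) := by rwa [← hcrit_iff q h1 h2]
      exact hfold_clause q h1 h2 h3 (h4 hcritG)
    · -- cusp point: nearby critical points other than `p` are fold points
      have hW : HasWhitneyCuspData (G p) (Φ p) :=
        hasWhitneyCuspData_of_simpleCusp (hG p) (hne p) hcc (htr p) (hcg p)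
      have hS4 : ∀ᶠ q in 𝓝 p, Φ q ≠ Φ p → ¬ Surjective (fderiv ℝ (G p) (Φ q)) →
          OneJet.IsFoldPointAt (G p) (Φ q) :=
        hcont.eventually hW.eventually_isFoldPointAt
      filter_upwards [hS1, hS2, hS3, hS4] with q h1 h2 h3 h4 hqp hcrit
      have hcritG : ¬ Surjective (fderiv ℝ (G p) (Φ q)) := by rwa [← hcrit_iff q h1 h2]
      have hΦne : Φ q ≠ Φ p := fun h => hqp (Φ.injOn h1 hpΦ h)
      exact hfold_clause q h1 h2 h3 (h4 hΦne hcritG)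
  -- the set of non-fold critical points is finite, by compactness
  set C : Set M := {q | ¬ Surjective (mfderiv (𝓡 4) (𝓡 2) g q) ∧ ¬ HasManifoldFoldChart g q}
    with hC
  have hEC : ∀ p : M, {q | q ∈ C → q = p} ∈ 𝓝 p := by
    intro p
    filter_upwards [hE p] with q hq hqC
    by_contra hqp
    exact hqC.2 (hq hqp hqC.1)
  obtain ⟨T, -, hTcov⟩ := isCompact_univ.elim_nhds_subcover (fun p => {q | q ∈ C → q = p})
    fun p _ => hEC p
  have hCT : ∀ c ∈ C, c ∈ T := by
    intro c hc
    have h := hTcov (mem_univ c)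
    simp only [mem_iUnion, exists_prop] at h
    obtain ⟨p, hpT, hcp⟩ := h
    rw [hcp hc]
    exact hpT
  refine ⟨g, hgs, hgsrc, T.filter (fun q => q ∈ C), ?_, ?_⟩
  · intro p hp
    rw [Finset.mem_filter] at hp
    obtain ⟨hcrit, hnf⟩ := hp.2
    rcases foldChart_or_whitneyCuspCharts_of_generic (hΦs p) (hΦss p) hΨ₀ hΨ₀s (hmaps p)
      (mem_chart_source _ p) (hG p) (hGf p) (hne p) (htr p) (hcg p) hcrit with hfold | hcusp
    · exact absurd hfold hnf
    · exact hcusp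
  · intro p hcrit hpS
    by_contra hnf
    exact hpS (Finset.mem_filter.2 ⟨hCT p ⟨hcrit, hnf⟩, ⟨hcrit, hnf⟩⟩)

/-- **Generic maps of a closed 4-manifold to the 2-sphere have finitely many cusps.**  Every
compact boundaryless `C^∞` 4-manifold carries a `C^∞` map `g : M → S²` and a finite set
`S ⊆ M` of cusp points with Whitney data in charts of `M` and `S²`, such that every critical
point of `g` off `S` is a fold point with charts `(t, s₁x² + s₂y² + s₃z²)`, `sᵢ = ±1`
(Baykur–Saeki §2.1: "folds and cusps", the cusps finitely many; the cusp chart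
`(t, x³ + tx ± y² ± z²)` follows from Whitney's planar theorem, GG VI Thm. 2.4, not formalised).
[cite: BaykurSaeki2017, §2.1 p. 6, §6 p. 19] [cite: GolubitskyGuillemin1973, Ch. VI §2] -/
theorem exists_generic_map_sphere_finite_cusps (M : Type*) [TopologicalSpace M] [T2Space M]
    [CompactSpace M] [ChartedSpace (𝔼 4) M] [IsManifold (𝓡 4) ∞ M] :
    ∃ g : M → 𝕊², ContMDiff (𝓡 4) (𝓡 2) ∞ g ∧ ∃ S : Finset M,
      (∀ p ∈ S, HasManifoldWhitneyCuspCharts g p) ∧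
      ∀ p : M, ¬ Surjective (mfderiv (𝓡 4) (𝓡 2) g p) → p ∉ S → HasManifoldFoldChart g p := by
  set P₀ : 𝕊² := ⟨EuclideanSpace.single (0 : Fin 3) (1 : ℝ), by simp⟩ with hP₀
  set Ψ₀ : OpenPartialHomeomorph 𝕊² (𝔼 2) := chartAt (𝔼 2) P₀ with hΨ₀
  have hΨ₀s : ContMDiffOn (𝓡 2) (𝓡 2) ∞ Ψ₀ Ψ₀.source := contMDiffOn_chart
  have hΨ₀ss : ContMDiffOn (𝓡 2) (𝓡 2) ∞ Ψ₀.symm Ψ₀.target := contMDiffOn_chart_symm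
  have htarget : Ψ₀.target = univ := by
    haveI : Fact (Module.finrank ℝ (𝔼 3) = 2 + 1) := ⟨by simp⟩
    show (stereographic' 2 (-P₀)).target = univ
    exact stereographic'_target (-P₀)
  obtain ⟨g, hg, -, S, hS, hfold⟩ := exists_generic_map_of_chart_finite_cusps Ψ₀ hΨ₀s hΨ₀ss htarget M
  exact ⟨g, hg, S, hS, hfold⟩

end Main

end Literature.Topology.FourManifolds
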